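import Summits.CriticalPhenomena.CardyFormulaZ2.Theorems.CardyWhiteToColouredSimilarityUpgradeStubDualSum
import Summits.CriticalPhenomena.CardyFormulaZ2.Theorems.CardyIKTransportRenewalGridHarmlessModuli
import Summits.CriticalPhenomena.CardyFormulaZ2.Theorems.DyadicBetaRigidityDyadicBetaSufficesBeta
import Summits.CriticalPhenomena.CardyFormulaZ2.Theorems.CardyTensorRGPolyominoGaussianLawDyadicCores
import Literature.Probability.RandomPlanarGeometry.ConformalRectangleProofs

/-!
# Both dyadic cores of the crux `PolyominoGaussianLaw` are closed under cyclic re-marking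
# (stmt-CriticalPhenomena-14337, route `CardyTensorRG`, line `registered`, skeleton v8:
# auxiliary stub `stub_coresShiftClosed`)

Let `R = (Ω; a, b, c, d)` be a conformal rectangle and `R' = (Ω; b, c, d, a)` its cyclic re-marking:
same carrier, marked points shifted by one (`R'.pt i = R.pt (i + 1)`), hence arcs shifted by one
(`R'.arc 0 = R.arc 1`, `R'.arc 2 = R.arc 3`). Fix `δ₀ > 0` and the dyadic mesh sequence `δ₀ · 2^(−k)`.

* (E) If the bond-`ℤ²` crossing probabilities of `R` along the dyadic sequence converge to `L`, those
  of `R'` converge to `1 - L`. Indeed `bondDomainCrossingProb R' δ` is, by definition of G02's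
  discretisation, the dual summand `discreteCrossingProb ½ Ω δ (R.arc 1) (R.arc 3)` of the tree's limit
  self-duality `SimilarityUpgrade.Stubs.stub_dualSum` (`P_δ(R) + P_δ(R') → 1` as `δ → 0⁺`, for EVERY
  conformal rectangle), read along `δ₀ · 2^(−k) → 0⁺` (`tendsto_dyadicMesh`).
* (I) If, for an exponent `a < 1`, every dyadic limit of `R` equals `I_a(η_R)` for every uniformizing
  datum of `R` (`I_a(η) = ∫₀^η (s(1-s))^{-a} ds / ∫₀¹ (s(1-s))^{-a} ds`, `η_R` the cross-ratio), then
  every dyadic limit `L'` of `R'` equals `I_a(η_{R'})` for every uniformizing datum of `R'`: by (E)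
  (with the roles of the two summands exchanged) the `R`-orbit converges to `1 - L'`, so
  `1 - L' = I_a(η_R)` for a uniformizing datum of `R` (which exists,
  `MarkedDomain.exists_isUniformizing_holds`); the conjugate marking has modulus
  `η_{R'} = 1 - η_R` (`CardyIKTransport.RenewalGridHarmless.crossRatio_eq_one_sub_of_pt_eq_succ`) and
  the beta law is symmetric, `I_a(1 - η) = 1 - I_a(η)` (`DyadicLattice.betaLaw_one_sub`).

References: B. Bollobás, O. Riordan, *Percolation* (2006), Ch. 7, eq. (4) and Ch. 3 Lemma 1;
V. Beffara, *Cardy's formula on the triangular lattice, the easy way* (2007), proof of Prop. 4;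
O. Schramm, S. Smirnov, Ann. Probab. 39 (2011), Cor. 5.2.
-/

noncomputable section

namespace Summit.CriticalPhenomena.CardyFormulaZ2.Cruxes.PolyominoGaussianLaw.Birth

open Filter Topology Set MeasureTheory
open Literature.Probability.RandomPlanarGeometry
open Literature.Probability.Percolation (bondDomainCrossingProb discreteCrossingProb half)
open Summit.CriticalPhenomena.CardyFormulaZ2.Cruxes.SimilarityUpgrade.Stubs (stub_dualSum)
open Summit.CriticalPhenomena.CardyFormulaZ2.Theorems.CardyIKTransport.RenewalGridHarmless
  (crossRatio_eq_one_sub_of_pt_eq_succ)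
open Summit.CriticalPhenomena.CardyFormulaZ2.Theorems.DyadicLattice (betaLaw_one_sub)

/-- **Dyadic self-duality for a re-marked pair.** If `R'` has the carrier of `R` and arcs
`R'.arc 0 = R.arc 1`, `R'.arc 2 = R.arc 3`, then along the dyadic mesh sequence `δ₀ · 2^(−k)` the
crossing probabilities of `R` and `R'` sum to `1` in the limit: `bondDomainCrossingProb R' δ` is
literally the dual summand of `stub_dualSum`, read along `tendsto_dyadicMesh`. [folklore] -/
theorem tendsto_dyadic_add_shift (R R' : ConformalRectangle) (hc : R'.carrier = R.carrier)
    (ha0 : R'.arc 0 = R.arc 1) (ha2 : R'.arc 2 = R.arc 3) {δ₀ : ℝ} (hδ₀ : 0 < δ₀) :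
    Tendsto (fun k : ℕ => bondDomainCrossingProb R (δ₀ / 2 ^ k) + bondDomainCrossingProb R' (δ₀ / 2 ^ k))
      atTop (𝓝 1) := by
  have hsnd : ∀ δ, bondDomainCrossingProb R' δ = discreteCrossingProb half R.carrier δ (R.arc 1) (R.arc 3) := by
    intro δ
    rw [bondDomainCrossingProb, hc, ha0, ha2]
  simp_rw [hsnd]
  exact (stub_dualSum R).comp (tendsto_dyadicMesh hδ₀)

/-- **Core E passes to the re-marking**: a dyadic limit `L` of `R` forces the dyadic limit `1 - L`
of `R'` (`tendsto_dyadic_add_shift` minus the `R`-orbit). [folklore] -/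
theorem tendsto_dyadic_shift_of_tendsto (R R' : ConformalRectangle) (hc : R'.carrier = R.carrier)
    (ha0 : R'.arc 0 = R.arc 1) (ha2 : R'.arc 2 = R.arc 3) {δ₀ : ℝ} (hδ₀ : 0 < δ₀) {L : ℝ}
    (hL : Tendsto (fun k : ℕ => bondDomainCrossingProb R (δ₀ / 2 ^ k)) atTop (𝓝 L)) :
    Tendsto (fun k : ℕ => bondDomainCrossingProb R' (δ₀ / 2 ^ k)) atTop (𝓝 (1 - L)) := by
  have h := (tendsto_dyadic_add_shift R R' hc ha0 ha2 hδ₀).sub hL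
  refine h.congr fun k => ?_
  ring

/-- **The `R`-orbit from the `R'`-orbit**: a dyadic limit `L'` of the re-marking `R'` forces the
dyadic limit `1 - L'` of `R` (`tendsto_dyadic_add_shift` minus the `R'`-orbit). [folklore] -/
theorem tendsto_dyadic_of_tendsto_shift (R R' : ConformalRectangle) (hc : R'.carrier = R.carrier)
    (ha0 : R'.arc 0 = R.arc 1) (ha2 : R'.arc 2 = R.arc 3) {δ₀ : ℝ} (hδ₀ : 0 < δ₀) {L' : ℝ}
    (hL' : Tendsto (fun k : ℕ => bondDomainCrossingProb R' (δ₀ / 2 ^ k)) atTop (𝓝 L')) :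
    Tendsto (fun k : ℕ => bondDomainCrossingProb R (δ₀ / 2 ^ k)) atTop (𝓝 (1 - L')) := by
  have h := (tendsto_dyadic_add_shift R R' hc ha0 ha2 hδ₀).sub hL'
  refine h.congr fun k => ?_
  ring

/-- aux stub 9 (v8). **Both cores are closed under cyclic re-marking.** For `R = (Ω; a, b, c, d)` and its
re-marking `R' = (Ω; b, c, d, a)` (same carrier, marks and arcs shifted by one) and every `δ₀ > 0`:
(E) if the dyadic orbit of `R` converges to `L`, that of `R'` converges to `1 - L` (limit self-duality
`stub_dualSum`: the crossing of `R'` is the dual crossing of `R`); (I) if every dyadic limit of `R` is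
`I_a(η_R)`, then every dyadic limit of `R'` is `I_a(η_{R'})`, because `η_{R'} = 1 - η_R`
(`crossRatio_eq_one_sub_of_pt_eq_succ`) and `I_a(1 - η) = 1 - I_a(η)` (`betaLaw_one_sub`). [folklore] -/
theorem stub_coresShiftClosed :
    ∀ R R' : Literature.Probability.RandomPlanarGeometry.ConformalRectangle, R'.carrier = R.carrier →
      (∀ i, R'.pt i = R.pt (i + 1)) → R'.arc 0 = R.arc 1 → R'.arc 2 = R.arc 3 → ∀ δ₀ : ℝ, 0 < δ₀ →
      (∀ L : ℝ, Filter.Tendsto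
          (fun k : ℕ => Literature.Probability.Percolation.bondDomainCrossingProb R (δ₀ / 2 ^ k))
          Filter.atTop (nhds L) →
        Filter.Tendsto
          (fun k : ℕ => Literature.Probability.Percolation.bondDomainCrossingProb R' (δ₀ / 2 ^ k))
          Filter.atTop (nhds (1 - L))) ∧
      ∀ a : ℝ, a < 1 →
        (∀ (φ : Literature.Probability.RandomPlanarGeometry.ConformalEquiv UpperHalfPlane.upperHalfPlaneSet R.carrier)
            (x : Fin 4 → ℝ), R.IsUniformizing φ x →
          ∀ L : ℝ, Filter.Tendsto
            (fun k : ℕ => Literature.Probability.Percolation.bondDomainCrossingProb R (δ₀ / 2 ^ k))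
            Filter.atTop (nhds L) →
            L = intervalIntegral (fun s : ℝ => (s * (1 - s)) ^ (-a)) 0
                  (Literature.Probability.RandomPlanarGeometry.crossRatio x) MeasureTheory.volume /
                intervalIntegral (fun s : ℝ => (s * (1 - s)) ^ (-a)) 0 1 MeasureTheory.volume) →
        ∀ (φ' : Literature.Probability.RandomPlanarGeometry.ConformalEquiv UpperHalfPlane.upperHalfPlaneSet R'.carrier)
          (x' : Fin 4 → ℝ), R'.IsUniformizing φ' x' →
        ∀ L' : ℝ, Filter.Tendsto
          (fun k : ℕ => Literature.Probability.Percolation.bondDomainCrossingProb R' (δ₀ / 2 ^ k))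
          Filter.atTop (nhds L') →
          L' = intervalIntegral (fun s : ℝ => (s * (1 - s)) ^ (-a)) 0
                (Literature.Probability.RandomPlanarGeometry.crossRatio x') MeasureTheory.volume /
              intervalIntegral (fun s : ℝ => (s * (1 - s)) ^ (-a)) 0 1 MeasureTheory.volume := by
  intro R R' hc hpt ha0 ha2 δ₀ hδ₀
  refine ⟨fun L hL => tendsto_dyadic_shift_of_tendsto R R' hc ha0 ha2 hδ₀ hL, ?_⟩
  intro a ha hI φ' x' hφ' L' hL'
  -- a uniformizing datum of `R`, and the `R`-orbit limit `1 - L'`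
  obtain ⟨φ, x, hφ⟩ := MarkedDomain.exists_isUniformizing_holds R
  have hR : 1 - L' = intervalIntegral (fun s : ℝ => (s * (1 - s)) ^ (-a)) 0 (crossRatio x) volume /
      intervalIntegral (fun s : ℝ => (s * (1 - s)) ^ (-a)) 0 1 volume :=
    hI φ x hφ (1 - L') (tendsto_dyadic_of_tendsto_shift R R' hc ha0 ha2 hδ₀ hL')
  -- the conjugate marking has modulus `1 - η`, and `I_a(1 - η) = 1 - I_a(η)`
  have hη : crossRatio x' = 1 - crossRatio x := crossRatio_eq_one_sub_of_pt_eq_succ hc hpt hφ hφ'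
  have hηmem : crossRatio x ∈ Icc (0 : ℝ) 1 :=
    Ioo_subset_Icc_self (ConformalRectangle.crossRatio_mem_Ioo_of_isUniformizing hφ)
  have hsymm := betaLaw_one_sub ha hηmem
  rw [hη, hsymm, ← hR]
  ring

end Summit.CriticalPhenomena.CardyFormulaZ2.Cruxes.PolyominoGaussianLaw.Birth

end
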